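import Summits.FinalStateConjecture.FinalStateConjecture.Theorems.DerivativeThriftThriftyHandoffSelfWitness
import Literature.Geometry.Lorentzian.TameGenericityDiagonal
import HarnessLib

/-!
# `ThriftyHandoff` (stmt-FinalStateConjecture-17612), line `registered` v3: NECESSITY of the genericity
# legs — the crux implies tame genericity of `UpgradableCensored`, hence the corrected transversality stub

Wave-2 bookkeeping of the line (worker findings `work/stubs/stub_recessionAlongCensoredCurves_v3.md` in
the lead's folder, 2026-08-17), landed as a record so that the v3 cut is certified HONEST (not over-cut,
in contrast with the birth cut, wave 1):

* `FullHandoff.weakHandoff` — a full thrifty hand-over is a weak one (sub-extremal labels are closed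
  labels; drop the velocity clause).
* `isTameChristodoulouGeneric_upgradableCensored_of_thriftyHandoff` — the crux implies TAME GENERICITY
  OF `UpgradableCensored` (`ThriftyProp → UpgradableCensored` pointwise: the crux's MGHDs carry full
  hand-overs outright; then `mono`).
* `stub_recessionAlongCensoredCurves_of_isTameChristodoulouGeneric` — tame genericity of
  `UpgradableCensored` implies the registered v3 stub `stub_recessionAlongCensoredCurves` (2b) verbatim
  (ignore the handed-in curve; apply genericity at the exceptional base datum `F 0`); hence
  `stub_recessionAlongCensoredCurves_of_thriftyHandoff`: **2b is a CONSEQUENCE of the crux** — an honest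
  leg, refutable only together with the crux.
* `isTameChristodoulouGeneric_upgradableCensored_of_legs` — conversely stubs 1 (item 17269) and 2b give
  tame genericity of `UpgradableCensored` (kernel `_of_relative'`, good half by the landed stub 2a
  `stub_upgradableSelfWitness`); with `weakCosmicCensorshipTame_of_isTameChristodoulouGeneric_upgradableCensored`
  (mono) the three stubs 1 ∧ 2a ∧ 2b are jointly EQUIVALENT to this one tame-genericity statement — the
  route's unfiled layer-2 node "generic legs" in its cleanest form.
* `isTameChristodoulouGeneric_weakCapture_of_thriftyHandoff` — the crux also implies the GENERIC shadow
  of the capture stub: tame-generically, an MGHD exists and every MGHD is censored and admits a weak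
  thrifty hand-over (stub 3 asserts the hand-over POINTWISE on censored MGHDs, which is more).

Pure logic over the Defs file and `TameGenericityDiagonal`; no definitions, no named facts.
-/

noncomputable section

-- D-0017: single-problem summit, `Summit.<S>.<S>.…` by design.
set_option linter.dupNamespace false

open Set Function
open scoped Manifold ContDiff Topology

namespace Summit.FinalStateConjecture.FinalStateConjecture.Theorems.DerivativeThriftThriftyHandoff

open Literature.Geometry.Lorentzian
open Summit.FinalStateConjecture.FinalStateConjecture.Theses.DerivativeThrift (ThriftyHandoff)
open Summit.FinalStateConjecture.FinalStateConjecture.Theses.PhaseMixingCapture (WeakCosmicCensorshipTame)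

section Pointwise

variable {X : Type} [TopologicalSpace X] [ChartedSpace E3 X] [IsManifold (𝓡 3) ∞ X] [ConnectedSpace X]
  {D : InitialDataSet (𝓡 3) X}

/-- **A full thrifty hand-over is a weak one**: sub-extremal labels are closed labels
(`Or.inl`), and the velocity clause is dropped. [folklore] -/
theorem FullHandoff.weakHandoff {𝒟 : VacuumCauchyDevelopment D} (h : FullHandoff 𝒟) : WeakHandoff 𝒟 := by
  obtain ⟨N, M, a, Λ, hsub, horth, -, h⟩ := h
  exact ⟨N, M, a, Λ, fun i ↦ Or.inl (hsub i), horth, h⟩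

/-- **`ThriftyProp → UpgradableCensored` pointwise**: the crux's MGHDs carry full hand-overs outright,
so the upgrade implication holds trivially. [folklore] -/
theorem ThriftyProp.upgradableCensored (h : ThriftyProp D) : UpgradableCensored D :=
  ⟨h.1, fun 𝒟 h𝒟 ↦ ⟨(h.2 𝒟 h𝒟).1, fun _ ↦ (h.2 𝒟 h𝒟).2.2⟩⟩

end Pointwise

/-- **The crux implies tame genericity of `UpgradableCensored`** (`ThriftyProp.upgradableCensored` and
`IsTameChristodoulouGeneric.mono`). Christodoulou, CQG 16 (1999) A23, p. A24. [cite: Christodoulou1999, p. A24] -/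
theorem isTameChristodoulouGeneric_upgradableCensored_of_thriftyHandoff (h : ThriftyHandoff) :
    ∀ (X : Type) [TopologicalSpace X] [ChartedSpace E3 X] [IsManifold (𝓡 3) ((⊤ : ℕ∞) : WithTop ℕ∞) X] [T2Space X] [SecondCountableTopology X] [ConnectedSpace X], InitialDataSet.IsTameChristodoulouGeneric (admissibleVacuumData X) (UpgradableCensored (X := X)) 1 := by
  intro X _ _ _ _ _ _
  exact (h X).mono fun D _ hQ ↦ ThriftyProp.upgradableCensored hQ

/-- **Tame genericity of `UpgradableCensored` implies the registered v3 transversality stub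
`stub_recessionAlongCensoredCurves` (2b) verbatim**: ignore the handed-in curve `F` and apply
genericity at the exceptional base datum `F 0` (`¬ UpgradableCensored (F 0)`). [folklore] -/
theorem stub_recessionAlongCensoredCurves_of_isTameChristodoulouGeneric
    (h : ∀ (X : Type) [TopologicalSpace X] [ChartedSpace E3 X] [IsManifold (𝓡 3) ((⊤ : ℕ∞) : WithTop ℕ∞) X] [T2Space X] [SecondCountableTopology X] [ConnectedSpace X], InitialDataSet.IsTameChristodoulouGeneric (admissibleVacuumData X) (UpgradableCensored (X := X)) 1) :
    open Literature.Geometry.Lorentzian Summit.FinalStateConjecture.FinalStateConjecture.Theorems.DerivativeThriftThriftyHandoff in open scoped Manifold in ∀ (X : Type) [TopologicalSpace X] [ChartedSpace E3 X] [IsManifold (𝓡 3) ((⊤ : ℕ∞) : WithTop ℕ∞) X] [T2Space X] [SecondCountableTopology X] [ConnectedSpace X], ∀ (e : AFEnd X) (F : EuclideanSpace ℝ (Fin 1) → InitialDataSet (𝓡 3) X), InitialDataSet.IsTameDataFamily e 1 F → ((InitialDataSet.IsImmersedAtZero 1 F ∧ Function.Injective F) ∨ ∀ c, F c = F 0) →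 (∀ c, F c ∈ admissibleVacuumData X) → ¬ UpgradableCensored (F 0) → (∀ c ≠ 0, Censored (F c)) → ∃ (e' : AFEnd X) (F' : EuclideanSpace ℝ (Fin 1) → InitialDataSet (𝓡 3) X), InitialDataSet.IsTameDataFamily e' 1 F' ∧ F' 0 = F 0 ∧ Function.Injective F' ∧ InitialDataSet.IsImmersedAtZero 1 F' ∧ (∀ c, F' c ∈ admissibleVacuumData X) ∧ ∀ c ≠ 0, UpgradableCensored (F' c) := by
  intro X _ _ _ _ _ _ e F hF hdich hadm hP hQ
  obtain ⟨e', F', hF', himm, h0, hinj, hadm', hgood⟩ := h X (F 0) ⟨hadm 0, hP⟩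
  refine ⟨e', F', hF', h0, hinj, himm, hadm', fun c hc ↦ ?_⟩
  by_contra hc'
  exact hgood c hc ⟨hadm' c, hc'⟩

/-- **The transversality stub (2b) is a consequence of the crux** — an honest leg of the v3 cut
(contrast the over-cut birth form, wave 1). [folklore] -/
theorem stub_recessionAlongCensoredCurves_of_thriftyHandoff (h : ThriftyHandoff) :
    open Literature.Geometry.Lorentzian Summit.FinalStateConjecture.FinalStateConjecture.Theorems.DerivativeThriftThriftyHandoff in open scoped Manifold in ∀ (X : Type) [TopologicalSpace X] [ChartedSpace E3 X] [IsManifold (𝓡 3) ((⊤ : ℕ∞) : WithTop ℕ∞) X] [T2Space X] [SecondCountableTopology X] [ConnectedSpace X], ∀ (e : AFEnd X) (F : EuclideanSpace ℝ (Fin 1) → InitialDataSet (𝓡 3) X), InitialDataSet.IsTameDataFamily e 1 F → ((InitialDataSet.IsImmersedAtZero 1 F ∧ Function.Injective F) ∨ ∀ c, F c = F 0) → (∀ c, F c ∈ admissibleVacuumData X) → ¬ UpgradableCensored (F 0) → (∀ c ≠ 0, Censored (F c)) → ∃ (e' : AFEnd X) (F' : EuclideanSpace ℝ (Fin 1) →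 InitialDataSet (𝓡 3) X), InitialDataSet.IsTameDataFamily e' 1 F' ∧ F' 0 = F 0 ∧ Function.Injective F' ∧ InitialDataSet.IsImmersedAtZero 1 F' ∧ (∀ c, F' c ∈ admissibleVacuumData X) ∧ ∀ c ≠ 0, UpgradableCensored (F' c) :=
  stub_recessionAlongCensoredCurves_of_isTameChristodoulouGeneric
    (isTameChristodoulouGeneric_upgradableCensored_of_thriftyHandoff h)

/-- **Conversely, stubs 1 and 2b give tame genericity of `UpgradableCensored`** (kernel
`isTameChristodoulouGeneric_of_relative'` with `Q := Censored`; its `hrel` by `by_cases` on the base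
datum, the good half by the landed stub 2a `stub_upgradableSelfWitness`). Christodoulou, CQG 16
(1999) A23, p. A24. [cite: Christodoulou1999, p. A24] -/
theorem isTameChristodoulouGeneric_upgradableCensored_of_legs (h₁ : WeakCosmicCensorshipTame)
    (h₂ : open Literature.Geometry.Lorentzian Summit.FinalStateConjecture.FinalStateConjecture.Theorems.DerivativeThriftThriftyHandoff in open scoped Manifold in ∀ (X : Type) [TopologicalSpace X] [ChartedSpace E3 X] [IsManifold (𝓡 3) ((⊤ : ℕ∞) : WithTop ℕ∞) X] [T2Space X] [SecondCountableTopology X] [ConnectedSpace X], ∀ (e : AFEnd X) (F : EuclideanSpace ℝ (Fin 1) → InitialDataSet (𝓡 3) X), InitialDataSet.IsTameDataFamily e 1 F → ((InitialDataSet.IsImmersedAtZero 1 F ∧ Function.Injective F) ∨ ∀ c, F c = F 0) → (∀ c, F c ∈ admissibleVacuumData X) → ¬ UpgradableCensored (F 0) → (∀ c ≠ 0, Censored (F c)) → ∃ (e' : AFEnd X) (F' : EuclideanSpace ℝ (Fin 1) → InitialDataSet (𝓡 3) X), InitialDataSet.IsTameDataFamily e' 1 F' ∧ F' 0 = F 0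 ∧ Function.Injective F' ∧ InitialDataSet.IsImmersedAtZero 1 F' ∧ (∀ c, F' c ∈ admissibleVacuumData X) ∧ ∀ c ≠ 0, UpgradableCensored (F' c)) :
    ∀ (X : Type) [TopologicalSpace X] [ChartedSpace E3 X] [IsManifold (𝓡 3) ((⊤ : ℕ∞) : WithTop ℕ∞) X] [T2Space X] [SecondCountableTopology X] [ConnectedSpace X], InitialDataSet.IsTameChristodoulouGeneric (admissibleVacuumData X) (UpgradableCensored (X := X)) 1 := by
  intro X _ _ _ _ _ _
  refine InitialDataSet.isTameChristodoulouGeneric_of_relative' (Q := Censored (X := X))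
    (fun d hd ↦ exists_isSoleEnd_of_mem_admissibleVacuumData hd) (h₁ X) ?_
  intro e F hF hdich hadm hQ
  by_cases hP : UpgradableCensored (F 0)
  · exact stub_upgradableSelfWitness X (F 0) (hadm 0) hP
  · exact h₂ X e F hF hdich hadm hP hQ

/-- **Tame genericity of `UpgradableCensored` implies item stmt-FinalStateConjecture-17269**
(`WeakCosmicCensorshipTame`) by `mono` (`UpgradableCensored.censored`): with the two previous theorems,
stubs 1 ∧ 2a ∧ 2b of the v3 skeleton are jointly EQUIVALENT to tame genericity of `UpgradableCensored`.
[folklore] -/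
theorem weakCosmicCensorshipTame_of_isTameChristodoulouGeneric_upgradableCensored
    (h : ∀ (X : Type) [TopologicalSpace X] [ChartedSpace E3 X] [IsManifold (𝓡 3) ((⊤ : ℕ∞) : WithTop ℕ∞) X] [T2Space X] [SecondCountableTopology X] [ConnectedSpace X], InitialDataSet.IsTameChristodoulouGeneric (admissibleVacuumData X) (UpgradableCensored (X := X)) 1) :
    WeakCosmicCensorshipTame := by
  intro X _ _ _ _ _ _
  exact (h X).mono fun D _ hD ↦ hD.censored

/-- **The crux implies the generic shadow of the capture stub**: tame-generically in the admissible
class an MGHD exists and every MGHD has complete `𝓘⁺` and admits a WEAK thrifty hand-over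
(`FullHandoff.weakHandoff`, `mono`). Stub 3 (`stub_censoredCapture`) asserts the weak hand-over
POINTWISE on every censored MGHD, which is strictly more. [folklore] -/
theorem isTameChristodoulouGeneric_weakCapture_of_thriftyHandoff (h : ThriftyHandoff) :
    ∀ (X : Type) [TopologicalSpace X] [ChartedSpace E3 X] [IsManifold (𝓡 3) ((⊤ : ℕ∞) : WithTop ℕ∞) X] [T2Space X] [SecondCountableTopology X] [ConnectedSpace X], InitialDataSet.IsTameChristodoulouGeneric (admissibleVacuumData X) (fun D ↦ (∃ 𝒟 : VacuumCauchyDevelopment D, 𝒟.IsMaximal) ∧ ∀ 𝒟 : VacuumCauchyDevelopment D, 𝒟.IsMaximal → Summit.FinalStateConjecture.HasCompleteNullInfinity 𝒟.toCauchyDevelopment ∧ WeakHandoff 𝒟) 1 := by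
  intro X _ _ _ _ _ _
  refine (h X).mono ?_
  intro D _ hQ
  exact ⟨hQ.1, fun 𝒟 h𝒟 ↦ ⟨(hQ.2 𝒟 h𝒟).1, FullHandoff.weakHandoff (hQ.2 𝒟 h𝒟).2.2⟩⟩

end Summit.FinalStateConjecture.FinalStateConjecture.Theorems.DerivativeThriftThriftyHandoff

end
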